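import Summits.CriticalPhenomena.PercolationContinuityZ3.Theorems.PercNearOneGluingNoHeavyQuantTreeBuiltRows
import Summits.CriticalPhenomena.PercolationContinuityZ3.Theorems.PercNearOneGluingNoHeavyQuantDeepLowsGiants
import HarnessLib

/-!
# QUANT lane R8 on trees: the TWO-LAYER TAIL CLASS as the inductive invariant — `TwoLayerConvClosed ⟹ FarTreeRow`
# with NO decomposition (DEC) data at all

builds on p205010 (kernel theorem, internal audit signed; external expert review pending)

Statement + support file (`--supports stmt-CriticalPhenomena-4575`), QUANT lane seat prim-quant-arm-2 (gen 38), rung R8 of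
`run/shared/lean/prim/quant/LADDER.md`; memo `run/shared/lean/prim/quant/prim-quant-arm-2-g38/TWO-LAYER-CLOSURE-G38.md`.
Two `Prop` definitions with parameters (`LawDec.TwoLayer`, `LawDec.STwoLayer`), one `@[conjecture]` (`LawDec.TwoLayerConvClosed`),
theorems with standard axioms, no sorries.

THE OBSERVATION.  Arm-2 g34 (`…QuantDeepLowsGiants`) derived from "DEC at every layer + top-affordable" the TWO-LAYER GIANT BOUNDS
`y·μ{h ≤ i′} ≤ (1−y)·μ{h > i}` (`i′ ≤ i`, `i + i′ < T`, `T` the mean) and proved with them that `SingleGateConvClosed` holds at every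
DOMINANT layer (`…QuantDominantClosure`).  Taking the largest `i` for each `i′ = c`, the family says: for every integer `c` with `2c < T`,
`u·P(X ≤ c) ≤ P(X ≥ T − c)`, `u = y/(1−y)` — the lower tail at `c` REFLECTED against the upper tail at `T − c` (equivalently: Hall's
condition for shipping every low atom `c` at rate `u` into the atoms `a ≥ T − c`, arm-2 g37's "compatible giants").  Its diagonal `i = i′`
is the far-relay row `y ≤ μ{h > i}` (`2i < T`).  THIS FILE makes the two-layer family itself the invariant of census-2 g53's structural
induction `treeBuilt_sdec`:
* `LawDec.TwoLayer y T M ν` — the family (verbatim the conclusion shape of `deepLows_le_giants`);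
* `LawDec.STwoLayer x M μ` — its gate-stable form: for every gate `0 < q ≤ 1`, `gate μ q` satisfies the family at floor `q·x` with
  threshold `q·(mean μ)` (the analogue of `LawDec.SDEC`);
* **`LawDec.TwoLayerConvClosed`** (`@[conjecture]`, "K-SGC"): in the binder of `LawDec.SingleGateConvClosed` (floor `0 < y < 1`, one gate
  `0 < q ≤ 1`, probability laws `μ₁`, `μ₂` whose gated versions are top-affordable at `y`) with "DEC at every layer" REPLACED by the two-layer
  family on both sides: `TwoLayer y (q·T₁) M₁ (gate μ₁ q)`, `TwoLayer y (q·T₂) M₂ (gate μ₂ q)` ⟹ `TwoLayer y (q·(T₁+T₂)) (M₁+M₂) (gate (lconv μ₁ μ₂) q)`.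
* KERNEL: `twoLayer_of_decAt_all` (the hypotheses of the new node are CONSEQUENCES of the old ones: `deepLows_le_giants`), `twoLayer_mono_floor`,
  `sTwoLayer_nil`, `sTwoLayer_relay`, `sTwoLayer_gate`, `sTwoLayer_mono`, the structural induction **`treeBuilt_sTwoLayer`**, and
  **`treeBuiltFAR_of_twoLayerConvClosed : TwoLayerConvClosed → TreeBuiltFAR`**, **`farTreeRow_of_twoLayerConvClosed : TwoLayerConvClosed → FarTreeRow`**
  (lead g20's bridge `farTreeRow_of_treeBuilt_rows`; the row is the diagonal pair `(j, j)` at `q = 1`).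
So R8 on trees follows from ONE inequality between the lower and upper TAILS of a gated independent sum — no flows, no mids, no credit pairs,
no cells, no decomposition oracle.  (`TwoLayerConvClosed` and `SingleGateConvClosed` are not formally comparable: both hypotheses and
conclusion are weaker here; both imply `FarTreeRow`.)

EVIDENCE (exact rationals, memo §2; engines `run/shared/lean/prim/quant/prim-quant-arm-2-g38/code/`): the statement is bilinear in
`(μ₁, μ₂)`, so extremal at vertex pairs of the two-layer polytopes `{μ on {0..M}: mean T, gate_q μ two-layer at (y, qT)}`; exact vertex
enumeration (simplex, random objectives) and ALL pairs within each `(q, y)` cell: `M ≤ 5`, `q ∈ {1, 9/10, 3/4, 1/2, 1/3}`: 413 547 pairs,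
**0 failures** (vertices include non-DEC laws and 4-atom laws); exact LPs "all `μ₁` of the polytope against a fixed `μ₂`": 0 negative minima
in 6 482; random / boundary-pushed / pseudo-law ⊗ tight-blob pairs ≈ 7 000 / 0; kit j211466 (cp4575, evidence → item 4575) scales the vertex
census to `M ≤ 8`.  SHARPNESS of the binder: the mean cap (threshold `= q·mean`) and top-affordability are both needed (mean-free version
40 / 20 000 false, TA-free 2 / 30 000); equality on blob ⊗ relay and blob ⊗ blob.  PROOF ON PAPER for `q = 1`, `y ≥ 1/2` (memo §3: row/column
reflections with disjoint images + one Hall transport of the second factor; `u ≥ 1` absorbs the second reflection); `y < 1/2` (needs a mean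
tilt) and `q < 1` (the gate's phantom zero) OPEN.
HONEST STATUS: `TwoLayerConvClosed`, `TreeBuiltFAR`, `FarTreeRow` OPEN; the reductions are kernel; nothing here is a published result; the
RATE class log\* and the honest sentence of `run/shared/lean/prim/quant/README.md` are unchanged.

[this work]; two-layer bounds: prim-quant-arm-2 g34; `TreeBuilt`/`treeBuilt_sdec`: prim-quant-census-2 g53; bridge: prim-quant-lead g20
(this lane).  The gluing rows served [cite: KozmaNitzan2024, Conjecture 3 (p. 15)]; product measure [cite: Grimmett1999, §1.3 p. 10].
-/

noncomputable section

namespace Summit.CriticalPhenomena.PercolationContinuityZ3.Theorems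

namespace Quant

open Finset

namespace LawDec

/-! ### The two-layer family and its gate-stable form -/

/-- **THE TWO-LAYER FAMILY** of a law `ν` on `{0..M}` at floor `y` and threshold `T`: for all layers `i′ ≤ i` with `i + i′ < T`,
`y·ν{h ≤ i′} ≤ (1−y)·ν{h > i}` — deep lows against giants (arm-2 g34 `deepLows_le_giants`); for `i′ = c`, `i = ⌈T−c⌉−1` it reads
`u·P(X ≤ c) ≤ P(X ≥ T − c)`; its diagonal `i = i′` is the far-relay row. [this work] -/
def TwoLayer (y T : ℝ) (M : ℕ) (ν : ℕ → ℝ) : Prop :=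
  ∀ i i' : ℕ, i' ≤ i → (i : ℝ) + i' < T →
    y * ∑ h ∈ Finset.range (M + 1), (if h ≤ i' then ν h else 0)
      ≤ (1 - y) * ∑ h ∈ Finset.range (M + 1), (if i + 1 ≤ h then ν h else 0)

/-- **GATE-STABLE TWO-LAYER** (the analogue of `LawDec.SDEC`): for every gate `0 < q ≤ 1` the gated law `gate μ q` satisfies the two-layer
family at floor `q·x` with threshold `q·(mean μ)`. [this work] -/
def STwoLayer (x : ℝ) (M : ℕ) (μ : ℕ → ℝ) : Prop :=
  ∀ q : ℝ, 0 < q → q ≤ 1 →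
    TwoLayer (q * x) (q * ∑ h ∈ Finset.range (M + 1), (h : ℝ) * μ h) M (gate μ q)

/-- **CONJECTURE (TWO-LAYER SINGLE-GATE CLOSURE, "K-SGC"; arm-2 g38).**  In the binder of `LawDec.SingleGateConvClosed` — floor
`0 < y < 1`, one gate `0 < q ≤ 1`, probability laws `μ₁` on `{0..M₁}`, `μ₂` on `{0..M₂}` whose gated versions are top-affordable at `y`
(`y·Mᵢ ≤ q·Σ h·μᵢ h`) — IF `gate μ₁ q` and `gate μ₂ q` satisfy the two-layer family at floor `y` with thresholds `q·T₁`, `q·T₂` (their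
means), THEN `gate (lconv M₁ M₂ μ₁ μ₂) q` satisfies it at floor `y` with threshold `q·(T₁ + T₂)`.  Exact evidence and the sharpness of the
binder in the module docstring; proof on paper for `q = 1`, `y ≥ 1/2`.  Implies `TreeBuiltFAR` and `Quant.FarTreeRow` (below).
builds on p205010 (kernel theorem, internal audit signed; external expert review pending). [this work] [status: open] -/
@[conjecture] def TwoLayerConvClosed : Prop :=
  ∀ (y q : ℝ) (M₁ M₂ : ℕ) (μ₁ μ₂ : ℕ → ℝ),
    0 < y → y < 1 → 0 < q → q ≤ 1 →
    (∀ h, 0 ≤ μ₁ h) → (∀ h, M₁ < h → μ₁ h = 0) → (∑ h ∈ Finset.range (M₁ + 1), μ₁ h = 1) →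
    y * (M₁ : ℝ) ≤ q * ∑ h ∈ Finset.range (M₁ + 1), (h : ℝ) * μ₁ h →
    (∀ h, 0 ≤ μ₂ h) → (∀ h, M₂ < h → μ₂ h = 0) → (∑ h ∈ Finset.range (M₂ + 1), μ₂ h = 1) →
    y * (M₂ : ℝ) ≤ q * ∑ h ∈ Finset.range (M₂ + 1), (h : ℝ) * μ₂ h →
    TwoLayer y (q * ∑ h ∈ Finset.range (M₁ + 1), (h : ℝ) * μ₁ h) M₁ (gate μ₁ q) →
    TwoLayer y (q * ∑ h ∈ Finset.range (M₂ + 1), (h : ℝ) * μ₂ h) M₂ (gate μ₂ q) →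
    TwoLayer y (q * ((∑ h ∈ Finset.range (M₁ + 1), (h : ℝ) * μ₁ h) + ∑ h ∈ Finset.range (M₂ + 1), (h : ℝ) * μ₂ h))
      (M₁ + M₂) (gate (lconv M₁ M₂ μ₁ μ₂) q)

/-! ### The new hypotheses are consequences of the old ones -/

/-- **DEC at every layer + top-affordable ⟹ the two-layer family** (arm-2 g34's `deepLows_le_giants`, restated). [this work] -/
theorem twoLayer_of_decAt_all (y T : ℝ) (M : ℕ) (μ : ℕ → ℝ) (hy0 : 0 < y) (hy1 : y < 1)
    (hμ0 : ∀ h, 0 ≤ μ h) (hμM : ∀ h, M < h → μ h = 0) (hμ1 : ∑ h ∈ Finset.range (M + 1), μ h = 1)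
    (hT : ∑ h ∈ Finset.range (M + 1), (h : ℝ) * μ h = T) (hta : y * (M : ℝ) ≤ T)
    (hdec : ∀ j', j' < M → DECAt y j' M μ) : TwoLayer y T M μ :=
  fun i i' hii hdeep => deepLows_le_giants y T M i i' μ hy0 hy1 hμ0 hμM hμ1 hT hta hdec hii hdeep

/-- **the two-layer family is monotone in the floor** (for a nonnegative law): lowering `y` only helps. [this work] -/
theorem twoLayer_mono_floor {y y' T : ℝ} {M : ℕ} {ν : ℕ → ℝ} (hν0 : ∀ h, 0 ≤ ν h) (h : TwoLayer y T M ν) (hyy : y' ≤ y) :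
    TwoLayer y' T M ν := by
  intro i i' hii hdeep
  have hA : 0 ≤ ∑ h ∈ Finset.range (M + 1), (if h ≤ i' then ν h else 0) :=
    Finset.sum_nonneg fun h _ => by split_ifs <;> [exact hν0 h; exact le_rfl]
  have hB : 0 ≤ ∑ h ∈ Finset.range (M + 1), (if i + 1 ≤ h then ν h else 0) :=
    Finset.sum_nonneg fun h _ => by split_ifs <;> [exact hν0 h; exact le_rfl]
  have := h i i' hii hdeep
  nlinarith [mul_le_mul_of_nonneg_right hyy hA, mul_le_mul_of_nonneg_right hyy hB]

/-- a gated nonnegative law is nonnegative (`q ≤ 1`). [this work] -/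
theorem gate_nonneg' {μ : ℕ → ℝ} (hμ0 : ∀ h, 0 ≤ μ h) {q : ℝ} (hq0 : 0 ≤ q) (hq1 : q ≤ 1) (h : ℕ) : 0 ≤ gate μ q h := by
  simp only [gate]
  split_ifs <;> nlinarith [hμ0 h]

/-! ### The invariant on the generators and under the tree operations -/

/-- **the empty law `δ₀` is gate-stable two-layer** (its mean is `0`: no pair `i + i′ < 0`). [this work] -/
theorem sTwoLayer_nil (x : ℝ) : STwoLayer x 0 (fun h => if h = 0 then (1 : ℝ) else 0) := by
  intro q _ _ i i' _ hdeep
  exfalso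
  have h0 : q * ∑ h ∈ Finset.range (0 + 1), (h : ℝ) * (if h = 0 then (1 : ℝ) else 0) = 0 := by simp
  rw [h0] at hdeep
  have : (0 : ℝ) ≤ (i : ℝ) + i' := by positivity
  linarith

/-- **the unit relay `δ₁` is gate-stable two-layer at every floor `x ≤ 1`**: `gate δ₁ q = {0: 1−q, 1: q}`, threshold `q ≤ 1`, so the only
pair is `i = i′ = 0`: `qx·(1−q) ≤ (1−qx)·q ⟸ x ≤ 1`. [this work] -/
theorem sTwoLayer_relay (x : ℝ) (hx1 : x ≤ 1) : STwoLayer x 1 (fun h => if h = 1 then (1 : ℝ) else 0) := by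
  intro q hq0 hq1 i i' hii hdeep
  have hmean : q * ∑ h ∈ Finset.range (1 + 1), (h : ℝ) * (if h = 1 then (1 : ℝ) else 0) = q := by
    simp
  rw [hmean] at hdeep
  have hi : i = 0 := by
    by_contra hne
    have : (1 : ℝ) ≤ (i : ℝ) := by exact_mod_cast Nat.one_le_iff_ne_zero.2 hne
    have : (0 : ℝ) ≤ (i' : ℝ) := Nat.cast_nonneg _
    linarith
  have hi' : i' = 0 := by omega
  subst hi; subst hi'
  have hL : ∑ h ∈ Finset.range (1 + 1), (if h ≤ 0 then gate (fun h => if h = 1 then (1 : ℝ) else 0) q h else 0) = 1 - q := by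
    simp [gate]
  have hR : ∑ h ∈ Finset.range (1 + 1), (if 0 + 1 ≤ h then gate (fun h => if h = 1 then (1 : ℝ) else 0) q h else 0) = q := by
    simp [Finset.sum_range_succ, gate]
  rw [hL, hR]
  nlinarith [mul_nonneg hq0.le (sub_nonneg.2 hx1), mul_nonneg hq0.le (sub_nonneg.2 hq1)]

/-- **gate-stable two-layer is gate-closed** (gates compose; the mean scales by the gate). [this work] -/
theorem sTwoLayer_gate {x : ℝ} {M : ℕ} {μ : ℕ → ℝ} (h : STwoLayer x M μ) (q : ℝ) (hq0 : 0 < q) (hq1 : q ≤ 1) :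
    STwoLayer (q * x) M (gate μ q) := by
  intro q' hq'0 hq'1
  rw [gate_gate, sum_mul_gate, show q' * (q * x) = (q' * q) * x by ring,
    show q' * (q * ∑ h ∈ Finset.range (M + 1), (h : ℝ) * μ h) = (q' * q) * ∑ h ∈ Finset.range (M + 1), (h : ℝ) * μ h by ring]
  exact h (q' * q) (mul_pos hq'0 hq0) (by nlinarith)

/-- **gate-stable two-layer is monotone in the floor** (`0 ≤ x′ ≤ x`, nonnegative law). [this work] -/
theorem sTwoLayer_mono {x x' : ℝ} {M : ℕ} {μ : ℕ → ℝ} (hμ0 : ∀ h, 0 ≤ μ h) (h : STwoLayer x M μ) (hxx : x' ≤ x) :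
    STwoLayer x' M μ := by
  intro q hq0 hq1
  exact twoLayer_mono_floor (gate_nonneg' hμ0 hq0.le hq1) (h q hq0 hq1) (mul_le_mul_of_nonneg_left hxx hq0.le)

/-- **THE STRUCTURAL INDUCTION with the two-layer invariant.**  Under `TwoLayerConvClosed`, every tree-built law (`LawDec.TreeBuilt x M μ`)
is a top-affordable probability law on `{0..M}` at a floor in `(0,1)` and is gate-stable two-layer there.  The law facts are census-2 g53's
(`treeBuilt_lawFacts`); the invariant: `δ₀`, `δ₁` by `sTwoLayer_nil`/`sTwoLayer_relay`, `lconv` by the conjecture at floor `q·x` for each gate,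
`gate` by `sTwoLayer_gate`, floor-lowering by `sTwoLayer_mono`. [this work] -/
theorem treeBuilt_sTwoLayer (hC : TwoLayerConvClosed) {x : ℝ} {M : ℕ} {μ : ℕ → ℝ} (h : TreeBuilt x M μ) :
    STwoLayer x M μ := by
  induction h with
  | nil x₀ hx0 hx1 => exact sTwoLayer_nil x₀
  | relay x₀ hx0 hx1 => exact sTwoLayer_relay x₀ hx1.le
  | @conv x₀ M₁ M₂ μ₁ μ₂ h₁ h₂ ih₁ ih₂ =>
    obtain ⟨hx0, hx1, n1, z1, s1, t1⟩ := treeBuilt_lawFacts h₁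
    obtain ⟨_, _, n2, z2, s2, t2⟩ := treeBuilt_lawFacts h₂
    intro q hq0 hq1
    have hy0 : 0 < q * x₀ := mul_pos hq0 hx0
    have hy1 : q * x₀ < 1 := by nlinarith
    have hta1 : q * x₀ * (M₁ : ℝ) ≤ q * ∑ h ∈ Finset.range (M₁ + 1), (h : ℝ) * μ₁ h := by
      rw [mul_assoc]; exact mul_le_mul_of_nonneg_left t1 hq0.le
    have hta2 : q * x₀ * (M₂ : ℝ) ≤ q * ∑ h ∈ Finset.range (M₂ + 1), (h : ℝ) * μ₂ h := by
      rw [mul_assoc]; exact mul_le_mul_of_nonneg_left t2 hq0.le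
    rw [sum_mul_lconv _ _ _ _ s1 s2]
    exact hC (q * x₀) q M₁ M₂ μ₁ μ₂ hy0 hy1 hq0 hq1 n1 z1 s1 hta1 n2 z2 s2 hta2 (ih₁ q hq0 hq1) (ih₂ q hq0 hq1)
  | @gate x₀ M₀ μ₀ q hq0 hq1 h ih => exact sTwoLayer_gate ih q hq0 hq1
  | @mono x₀ x' M₀ μ₀ h hx'0 hxx ih =>
    obtain ⟨_, _, n1, _, _, _⟩ := treeBuilt_lawFacts h
    exact sTwoLayer_mono n1 ih hxx

/-! ### The row at the root -/

/-- tail in the `ite` form equals the `Ico` sum. [this work] -/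
theorem sum_ite_succ_le_eq_Ico (M j : ℕ) (μ : ℕ → ℝ) :
    ∑ h ∈ Finset.range (M + 1), (if j + 1 ≤ h then μ h else 0) = ∑ h ∈ Finset.Ico (j + 1) (M + 1), μ h := by
  rw [← Finset.sum_filter]
  refine Finset.sum_congr ?_ fun _ _ => rfl
  ext h
  simp only [Finset.mem_filter, Finset.mem_range, Finset.mem_Ico]
  omega

/-- **`TwoLayerConvClosed ⟹ TreeBuiltFAR`**: at `q = 1` (`gate μ 1 = μ`) the diagonal pair `(j, j)` of the two-layer family is
`x·μ{≤ j} ≤ (1−x)·μ{> j}`, i.e. `x ≤ μ{> j}` since the two parts sum to the mass `1`. [this work] -/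
theorem treeBuiltFAR_of_twoLayerConvClosed (hC : TwoLayerConvClosed) : TreeBuiltFAR := by
  intro x M μ h j hdom
  obtain ⟨hx0, hx1, n1, z1, s1, t1⟩ := treeBuilt_lawFacts h
  have hS := treeBuilt_sTwoLayer hC h 1 one_pos le_rfl
  rw [gate_one, one_mul, one_mul] at hS
  have hjj := hS j j le_rfl (by linarith)
  have hsplit := sum_le_add_sum_gt M j μ
  rw [s1] at hsplit
  rw [← sum_ite_succ_le_eq_Ico]
  nlinarith [hjj, hsplit]

end LawDec

/-- **`TwoLayerConvClosed ⟹ Quant.FarTreeRow`** (lead g20's bridge `farTreeRow_of_treeBuilt_rows`): R8 on trees follows from the closure of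
the two-layer TAIL family under the gated product — no decomposition data. [this work] -/
theorem farTreeRow_of_twoLayerConvClosed (hC : LawDec.TwoLayerConvClosed) : FarTreeRow :=
  farTreeRow_of_treeBuiltFAR (LawDec.treeBuiltFAR_of_twoLayerConvClosed hC)

end Quant

end Summit.CriticalPhenomena.PercolationContinuityZ3.Theorems

/-! ## CORRECTION OF RECORD (lead g37, appended the same morning): `TwoLayerConvClosed` IS FALSE

The node above is binder-identical to `LawDec.TLBGateConvClosed` of `…QuantTLBClosure` (lead g37, landed five minutes earlier); both are
REFUTED by the same exact witness (lead g37 kit adversary j211243/j211244; ARM-REF g107, arm-3 g144, census-2 g63 countersigned): `q = 1`,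
`y = 9/20`, `μ₁ = {0: 11/20, 1: 9/20}` (`= gate δ₁ (9/20)`, a tree law), `μ₂ = {1: 33/61, 2: 11/1220, 4: 9/1220, 12: 27/61}` (mean `59/10`,
top-affordable, the whole two-layer family holds — tightly at `i′ = 1, 2` — but `μ₂` is not DEC); the convolution violates the pair
`(i, i′) = (4, 2)` (`4 + 2 < 127/20`) by `9/12200`.  Every violation found has floor `y < 1/2`; the HEAVY half (`1/2 ≤ y`) is typed and reduced
to the tree row on heavy forests in `…QuantTLBClosureHeavy` (lead g37), with arm-2 g38's paper proof for `q = 1`.  The docstring's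
`[status: open]` above is superseded by `not_twoLayerConvClosed` below (append-only file). -/

namespace Summit.CriticalPhenomena.PercolationContinuityZ3.Theorems

namespace Quant

open Finset

namespace LawDec

/-- **`TwoLayerConvClosed` IS FALSE** (lead g37; the witness of `LawDec.not_tlbGateConvClosed` in arm-2's `(i, i′)` indexing). [this work] -/
theorem not_twoLayerConvClosed : ¬ TwoLayerConvClosed := by
  intro H
  have hy0 : (0 : ℝ) < 9 / 20 := by norm_num
  have hy1 : (9 / 20 : ℝ) < 1 := by norm_num
  let μ₁ : ℕ → ℝ := fun h => if h = 0 then 11 / 20 else if h = 1 then 9 / 20 else 0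
  let μ₂ : ℕ → ℝ := fun h => if h = 1 then 33 / 61 else if h = 2 then 11 / 1220 else if h = 4 then 9 / 1220 else
    if h = 12 then 27 / 61 else 0
  have n1 : ∀ h, 0 ≤ μ₁ h := by intro h; simp only [μ₁]; split_ifs <;> norm_num
  have z1 : ∀ h, 1 < h → μ₁ h = 0 := by intro h hh; simp only [μ₁]; rw [if_neg (by omega), if_neg (by omega)]
  have s1 : ∑ h ∈ Finset.range (1 + 1), μ₁ h = 1 := by simp only [μ₁, Finset.sum_range_succ, Finset.sum_range_zero]; norm_num
  have m1 : ∑ h ∈ Finset.range (1 + 1), (h : ℝ) * μ₁ h = 9 / 20 := by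
    simp only [μ₁, Finset.sum_range_succ, Finset.sum_range_zero]; norm_num
  have n2 : ∀ h, 0 ≤ μ₂ h := by intro h; simp only [μ₂]; split_ifs <;> norm_num
  have z2 : ∀ h, 12 < h → μ₂ h = 0 := by
    intro h hh; simp only [μ₂]; rw [if_neg (by omega), if_neg (by omega), if_neg (by omega), if_neg (by omega)]
  have s2 : ∑ h ∈ Finset.range (12 + 1), μ₂ h = 1 := by simp only [μ₂, Finset.sum_range_succ, Finset.sum_range_zero]; norm_num
  have m2 : ∑ h ∈ Finset.range (12 + 1), (h : ℝ) * μ₂ h = 59 / 10 := by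
    simp only [μ₂, Finset.sum_range_succ, Finset.sum_range_zero]; norm_num
  have t1 : (9 / 20 : ℝ) * ((1 : ℕ) : ℝ) ≤ 1 * ∑ h ∈ Finset.range (1 + 1), (h : ℝ) * μ₁ h := by rw [m1]; norm_num
  have t2 : (9 / 20 : ℝ) * ((12 : ℕ) : ℝ) ≤ 1 * ∑ h ∈ Finset.range (12 + 1), (h : ℝ) * μ₂ h := by rw [m2]; norm_num
  have c1 : TwoLayer (9 / 20) (1 * ∑ h ∈ Finset.range (1 + 1), (h : ℝ) * μ₁ h) 1 (gate μ₁ 1) := by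
    rw [m1, gate_one]
    intro i i' hi'i hsum
    have hi0 : i = 0 := by
      by_contra hne
      have : (1 : ℝ) ≤ i := by exact_mod_cast Nat.one_le_iff_ne_zero.mpr hne
      have : (0 : ℝ) ≤ i' := by positivity
      linarith
    subst hi0
    have hi'0 : i' = 0 := by omega
    subst hi'0
    simp only [μ₁, Finset.sum_range_succ, Finset.sum_range_zero]
    norm_num
  have c2 : TwoLayer (9 / 20) (1 * ∑ h ∈ Finset.range (12 + 1), (h : ℝ) * μ₂ h) 12 (gate μ₂ 1) := by
    rw [m2, gate_one]
    intro i i' hi'i hsum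
    have hi5 : i ≤ 5 := by
      by_contra hne
      have : (6 : ℝ) ≤ i := by exact_mod_cast Nat.lt_of_not_le hne
      have : (0 : ℝ) ≤ i' := by positivity
      linarith
    have hii : (i : ℝ) + i' < 59 / 10 := by linarith
    interval_cases i <;> interval_cases i' <;>
      (simp only [μ₂, Finset.sum_range_succ, Finset.sum_range_zero]; norm_num) <;>
      (exfalso; norm_num at hii)
  have P := H (9 / 20) 1 1 12 μ₁ μ₂ hy0 hy1 one_pos le_rfl n1 z1 s1 t1 n2 z2 s2 t2 c1 c2
  rw [m1, m2, gate_one] at P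
  have P2 := P 4 2 (by norm_num) (by norm_num)
  simp only [lconv, μ₁, μ₂, Finset.sum_range_succ, Finset.sum_range_zero] at P2
  norm_num at P2

end LawDec

end Quant

end Summit.CriticalPhenomena.PercolationContinuityZ3.Theorems
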